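import Summits.ResolutionOfSingularities.ResolutionOfSingularities.Theorems.FrobeniusLadderFInjectiveMacaulayficationClosedPointLocalResolutionAdmTr
import Summits.ResolutionOfSingularities.ResolutionOfSingularities.Theorems.FrobeniusLadderFInjectiveMacaulayficationFTemkinClosedPoints
import Mathlib.RingTheory.Jacobson.Ring
import HarnessLib

/-!
# (LR_adm) ⟺ THE TRANSCENDENTAL-FIELD RUNGS AT ALL LEVELS `e ≥ 4`, `r ≥ 1` — the converse by SPREADING OUT
# (crux `FInjectiveMacaulayfication` stmt-ResolutionOfSingularities-15315, chain w45a; res-L1-w45a-plan-1 SEAT TABLE v31.2 / res-L1-w45a-lead-1 03:50:22Z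
# «a closed-point-language door waits for an `(LR_adm) ⟺ CPLRATr-all-levels` iff»; seat res-L1-w45a-stub-3 g8)

[OURS · L1 W4.5a] Support file (`--supports stmt-ResolutionOfSingularities-15315 --as helper`); replaces the role of NO printed item; NOT a statement of any
manuscript; def-free, no named facts. AI-written (AI review is weaker than expert review).

`ClosedPointLocalResolutionAdmTr.localResolutionNonClosedGe4Adm_of_tr` (p602502) proved (LR_adm) ⟸ {CPLRA-Tr p e r : e ≥ 4, r ≥ 1}. This file proves the
CONVERSE, so that the registered resolution-side stub of door v37 is EQUIVALENT to the closed-point ladder over purely transcendental fields: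

  **`localResolutionNonClosedGe4Adm_iff_tr : (LR_adm) ↔ ∀ p e r, p.Prime → 4 ≤ e → 1 ≤ r → ClosedPointLocalResolutionAdmTr p e r`.**

## Route (spreading out, then (LR_adm) at a non-closed point)
* §1 `exists_spread_ring` (commutative algebra). `K = k(X₁,…,X_r) = Frac R`, `R = k[X₁,…,X_r]`; `B` a domain of finite type over `K`, `𝔮 ⊂ B` a prime,
  `L = B_𝔮`. Let `B₀ := R[t] ⊆ B` for a finite generating set `t` of `B` over `K`: a domain of finite type over `k`; every `b ∈ B` has `s·b ∈ B₀` for some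
  `s ∈ R ∖ 0` (induction on `K[t]`), so `L = B_𝔮 = (B₀)_x` for `x := 𝔮 ∩ B₀`; and if `r ≥ 1` then `x` is NOT maximal: otherwise `B₀/x` is a field of finite
  type over `k`, hence finite over `k` (Zariski's lemma, Mathlib `finite_of_finite_type_of_isJacobsonRing`), and `R ↪ B₀/x` (non-zero elements of `R` are
  units of `B`, hence outside `𝔮`) would make `X₁` algebraic over `k`.
* §2 `closedPointLocalResolutionAdmTr_of_LRadm` (schemes). `Y/K` integral separated of finite type with `dim Y = e`, `y` closed: with `B = Γ(Y, V)` for an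
  affine `V ∋ y`, the `k`-variety `X := Spec B₀` has the NON-closed point `x` with `𝒪_{X,x} ≅ 𝒪_{Y,y}` (so `dim 𝒪_{X,x} = e ≥ 4`), and (LR_adm) at `(k, X, x)`
  moves to `Spec 𝒪_{Y,y}` along the isomorphism (`NonClosedPointChart.localBody_of_iso`). §3 the iff.

[folklore (EGA IV₃ §8 spreading out; Zariski's lemma); cite: EGAIV3, (8.8.2); Matsumura1987, Thm. 5.2 (Zariski's lemma); Temkin2008, §2.1]
-/

-- single-problem summit: the doubled namespace component is forced
set_option linter.dupNamespace false

noncomputable section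

namespace Summit.ResolutionOfSingularities.ResolutionOfSingularities.Theorems.FInjectiveMacaulayfication.LRadmIffTr

open CategoryTheory AlgebraicGeometry TopologicalSpace IsLocalRing
open Literature.AlgebraicGeometry.Resolution
open Summit.ResolutionOfSingularities.ResolutionOfSingularities.Theorems.FInjectiveMacaulayfication
open ClosedPointLocalResolutionAdmTr

/-! ## §1 Spreading out a finite-type algebra over `k(X₁,…,X_r)` to a finite-type algebra over `k` -/

/-- **SPREADING OUT.** `B` a domain of finite type over `K = Frac k[X₁,…,X_r]`, `𝔮` a prime of `B`, `L = B_𝔮`: there is a domain `B₀` of finite type over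
`k` with a prime `x` such that `L = (B₀)_x`, and `x` maximal forces `r = 0`. (`B₀ = k[X][t]` for generators `t` of `B` over `K`; Zariski's lemma.)
[folklore; cite: EGAIV3, (8.8.2); Matsumura1987, Thm. 5.2] -/
theorem exists_spread_ring (k : Type) [Field k] (r : ℕ) (B : Type) [CommRing B] [IsDomain B]
    [Algebra (FractionRing (MvPolynomial (Fin r) k)) B] [Algebra.FiniteType (FractionRing (MvPolynomial (Fin r) k)) B]
    (𝔮 : Ideal B) [𝔮.IsPrime] (L : Type) [CommRing L] [Algebra B L] [IsLocalization.AtPrime L 𝔮] :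
    ∃ (B₀ : Type) (_ : CommRing B₀) (_ : IsDomain B₀) (_ : Algebra k B₀) (_ : Algebra.FiniteType k B₀)
      (x : Ideal B₀) (_ : x.IsPrime) (_ : Algebra B₀ L), IsLocalization.AtPrime L x ∧ (x.IsMaximal → r = 0) := by
  classical
  set R := MvPolynomial (Fin r) k with hR
  set K := FractionRing (MvPolynomial (Fin r) k) with hK
  haveI : IsLocalRing L := IsLocalization.AtPrime.isLocalRing L 𝔮
  -- `B` as an `R`-algebra through `K`
  letI algRB : Algebra R B := ((algebraMap K B).comp (algebraMap R K)).toAlgebra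
  haveI : IsScalarTower R K B := IsScalarTower.of_algebraMap_eq (fun _ => rfl)
  -- non-zero elements of `R` are units of `B`, hence outside `𝔮`
  have hunitR : ∀ s : R, s ≠ 0 → IsUnit (algebraMap R B s) := by
    intro s hs
    rw [IsScalarTower.algebraMap_apply R K B]
    exact ((IsFractionRing.to_map_ne_zero_of_mem_nonZeroDivisors (mem_nonZeroDivisors_of_ne_zero hs) :
      algebraMap R K s ≠ 0).isUnit).map _
  have hnot𝔮 : ∀ s : R, s ≠ 0 → algebraMap R B s ∉ 𝔮 := fun s hs h =>
    Ideal.IsPrime.ne_top' (Ideal.eq_top_of_isUnit_mem 𝔮 h (hunitR s hs))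
  -- `B₀ := R[t]` for a finite generating set `t` of `B` over `K`
  obtain ⟨t, ht⟩ := Algebra.FiniteType.out (R := K) (A := B)
  let B₀ : Subalgebra R B := Algebra.adjoin R (t : Set B)
  -- every element of `B` has a denominator in `R ∖ 0` landing it in `B₀`
  have hden : ∀ b : B, ∃ s : R, s ≠ 0 ∧ algebraMap R B s * b ∈ B₀ := by
    intro b
    have hb : b ∈ Algebra.adjoin K (t : Set B) := by rw [ht]; trivial
    refine Algebra.adjoin_induction (hx := hb) ?_ ?_ ?_ ?_
    · exact fun y hy => ⟨1, one_ne_zero, by rw [map_one, one_mul]; exact Algebra.subset_adjoin hy⟩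
    · intro c
      obtain ⟨⟨a, s⟩, rfl⟩ := IsLocalization.mk'_surjective (nonZeroDivisors R) c
      refine ⟨s, nonZeroDivisors.ne_zero s.2, ?_⟩
      have : algebraMap R B s * algebraMap K B (IsLocalization.mk' K a s) = algebraMap R B a := by
        rw [IsScalarTower.algebraMap_apply R K B, ← map_mul, IsLocalization.mul_mk'_eq_mk'_of_mul, IsLocalization.mk'_mul_cancel_left,
          ← IsScalarTower.algebraMap_apply]
      rw [this]
      exact Subalgebra.algebraMap_mem B₀ a
    · rintro y z - - ⟨s₁, hs₁, hy⟩ ⟨s₂, hs₂, hz⟩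
      refine ⟨s₁ * s₂, mul_ne_zero hs₁ hs₂, ?_⟩
      have : algebraMap R B (s₁ * s₂) * (y + z) = algebraMap R B s₂ * (algebraMap R B s₁ * y) + algebraMap R B s₁ * (algebraMap R B s₂ * z) := by
        rw [map_mul]; ring
      rw [this]
      exact add_mem (B₀.mul_mem (Subalgebra.algebraMap_mem B₀ s₂) hy) (B₀.mul_mem (Subalgebra.algebraMap_mem B₀ s₁) hz)
    · rintro y z - - ⟨s₁, hs₁, hy⟩ ⟨s₂, hs₂, hz⟩
      refine ⟨s₁ * s₂, mul_ne_zero hs₁ hs₂, ?_⟩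
      have : algebraMap R B (s₁ * s₂) * (y * z) = (algebraMap R B s₁ * y) * (algebraMap R B s₂ * z) := by
        rw [map_mul]; ring
      rw [this]
      exact B₀.mul_mem hy hz
  -- `B₀` is a domain of finite type over `k`
  letI algkB₀ : Algebra k B₀ := ((algebraMap R B₀).comp (algebraMap k R)).toAlgebra
  haveI : IsScalarTower k R B₀ := IsScalarTower.of_algebraMap_eq (fun _ => rfl)
  have hB₀fg : B₀.FG := Subalgebra.fg_adjoin_finset _
  haveI : Algebra.FiniteType R B₀ := B₀.fg_iff_finiteType.mp hB₀fg
  haveI hB₀ft : Algebra.FiniteType k B₀ := Algebra.FiniteType.trans (S := R) inferInstance inferInstance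
  -- the prime `x := 𝔮 ∩ B₀` and `L = (B₀)_x`
  let x : Ideal B₀ := 𝔮.comap B₀.val.toRingHom
  haveI hxp : x.IsPrime := Ideal.comap_isPrime _ _
  letI algB₀L : Algebra B₀ L := ((algebraMap B L).comp B₀.val.toRingHom).toAlgebra
  have halg : ∀ b : B₀, algebraMap B₀ L b = algebraMap B L (b : B) := fun _ => rfl
  have hloc : IsLocalization.AtPrime L x := by
    rw [IsLocalization.AtPrime, isLocalization_iff]
    refine ⟨?_, ?_, ?_⟩
    · rintro ⟨b, hb⟩
      rw [halg]
      exact IsLocalization.map_units L (⟨(b : B), hb⟩ : 𝔮.primeCompl)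
    · intro z
      obtain ⟨⟨b, u⟩, hz⟩ := IsLocalization.surj 𝔮.primeCompl z
      obtain ⟨s₁, hs₁, hb₁⟩ := hden b
      obtain ⟨s₂, hs₂, hu₂⟩ := hden u
      have hu' : algebraMap R B s₂ * (u : B) * algebraMap R B s₁ ∉ 𝔮 := by
        intro h
        rcases (inferInstance : 𝔮.IsPrime).mem_or_mem h with h | h
        · rcases (inferInstance : 𝔮.IsPrime).mem_or_mem h with h | h
          · exact hnot𝔮 s₂ hs₂ h
          · exact u.2 h
        · exact hnot𝔮 s₁ hs₁ h
      refine ⟨⟨⟨algebraMap R B s₁ * b * algebraMap R B s₂, B₀.mul_mem hb₁ (Subalgebra.algebraMap_mem B₀ s₂)⟩,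
        ⟨⟨algebraMap R B s₂ * (u : B) * algebraMap R B s₁, B₀.mul_mem hu₂ (Subalgebra.algebraMap_mem B₀ s₁)⟩, hu'⟩⟩, ?_⟩
      simp only [halg, map_mul]
      have hz' : z * algebraMap B L (u : B) = algebraMap B L b := hz
      calc z * (algebraMap B L (algebraMap R B s₂) * algebraMap B L (u : B) * algebraMap B L (algebraMap R B s₁))
          = (z * algebraMap B L (u : B)) * algebraMap B L (algebraMap R B s₂) * algebraMap B L (algebraMap R B s₁) := by ring
        _ = algebraMap B L b * algebraMap B L (algebraMap R B s₂) * algebraMap B L (algebraMap R B s₁) := by rw [hz']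
        _ = algebraMap B L (algebraMap R B s₁) * algebraMap B L b * algebraMap B L (algebraMap R B s₂) := by ring
    · intro a a' h
      rw [halg, halg] at h
      obtain ⟨u, hu⟩ := IsLocalization.exists_of_eq (M := 𝔮.primeCompl) h
      obtain ⟨s, hs, hus⟩ := hden u
      have hu' : algebraMap R B s * (u : B) ∉ 𝔮 := fun h' => by
        rcases (inferInstance : 𝔮.IsPrime).mem_or_mem h' with h' | h'
        · exact hnot𝔮 s hs h'
        · exact u.2 h'
      refine ⟨⟨⟨algebraMap R B s * (u : B), hus⟩, hu'⟩, ?_⟩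
      apply Subtype.ext
      show algebraMap R B s * (u : B) * (a : B) = algebraMap R B s * (u : B) * (a' : B)
      rw [mul_assoc, mul_assoc, hu]
  -- `x` maximal forces `r = 0` (Zariski's lemma)
  have hmax : x.IsMaximal → r = 0 := by
    intro hxmax
    by_contra hr
    have hr' : 0 < r := Nat.pos_of_ne_zero hr
    letI : Field (B₀ ⧸ x) := Ideal.Quotient.field x
    haveI : Algebra.FiniteType k (B₀ ⧸ x) := Algebra.FiniteType.trans (S := B₀) hB₀ft inferInstance
    haveI : Module.Finite k (B₀ ⧸ x) := finite_of_finite_type_of_isJacobsonRing k (B₀ ⧸ x)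
    haveI : Algebra.IsIntegral k (B₀ ⧸ x) := Algebra.IsIntegral.of_finite k (B₀ ⧸ x)
    -- the `k`-algebra map `R → B₀/x` is injective
    let φ : R →ₐ[k] B₀ ⧸ x := (Ideal.Quotient.mkₐ k x).comp (IsScalarTower.toAlgHom k R B₀)
    have hφ : Function.Injective φ := by
      rw [injective_iff_map_eq_zero]
      intro a ha
      by_contra ha0
      have hmem : algebraMap R B₀ a ∈ x := by
        have : Ideal.Quotient.mk x (algebraMap R B₀ a) = 0 := ha
        exact Ideal.Quotient.eq_zero_iff_mem.mp this
      exact hnot𝔮 a ha0 hmem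
    -- so `X₀ ∈ R` would be integral over `k`
    have hint : IsIntegral k (MvPolynomial.X (⟨0, hr'⟩ : Fin r) : R) :=
      (isIntegral_algHom_iff φ hφ).mp (Algebra.IsIntegral.isIntegral _)
    exact (MvPolynomial.algebraicIndependent_X (Fin r) k).transcendental ⟨0, hr'⟩ hint.isAlgebraic
  exact ⟨B₀, inferInstance, inferInstance, algkB₀, hB₀ft, x, hxp, algB₀L, hloc, hmax⟩

/-! ## §2 The converse: (LR_adm) ⇒ the transcendental-field rung at every level `e ≥ 4`, `r ≥ 1` -/

/-- **(LR_adm) ⇒ `ClosedPointLocalResolutionAdmTr p e r` for `e ≥ 4`, `r ≥ 1`.** A closed point `y` of an integral `e`-fold `Y` over `k(X₁,…,X_r)` is, after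
spreading out an affine neighbourhood to a finite-type `k`-algebra (§1), a NON-closed point `x` of an integral affine `k`-variety `X` with
`𝒪_{X,x} ≅ 𝒪_{Y,y}` (so `dim 𝒪_{X,x} = e ≥ 4`); (LR_adm) at `(k, X, x)` moves to `Spec 𝒪_{Y,y}` along the isomorphism. [OURS · reduction; folklore]
[cite: EGAIV3, (8.8.2); Temkin2008, §2.1] -/
theorem closedPointLocalResolutionAdmTr_of_LRadm (h : RegularOffFiniteOfLRAdm.LocalResolutionNonClosedGe4Adm) :
    ∀ p e r : ℕ, p.Prime → 4 ≤ e → 1 ≤ r → ClosedPointLocalResolutionAdmTr p e r := by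
  intro p e r hp he hr k _ _ Y g hsep hft hqc hint hdim y hy
  classical
  haveI := hft
  haveI := hqc
  haveI := hint
  -- an affine open `V ∋ y`; `B := Γ(Y, V)` is a finite-type `K`-domain and `𝒪_{Y,y} = B_𝔮`
  obtain ⟨_, ⟨V, hV, rfl⟩, hyV, -⟩ := Y.isBasis_affineOpens.exists_subset_of_mem_open (Set.mem_univ y) isOpen_univ
  haveI : Nonempty (V : Y.Opens) := ⟨⟨y, hyV⟩⟩
  have h1 : (g.appLE ⊤ V le_top).hom.FiniteType := g.finiteType_appLE (isAffineOpen_top _) hV le_top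
  have h2 : (Scheme.ΓSpecIso (.of (FractionRing (MvPolynomial (Fin r) k)))).inv.hom.FiniteType :=
    RingHom.FiniteType.of_surjective _ (Scheme.ΓSpecIso (.of _)).symm.commRingCatIsoToRingEquiv.surjective
  letI : Algebra (FractionRing (MvPolynomial (Fin r) k)) Γ(Y, V) :=
    ((g.appLE ⊤ V le_top).hom.comp (Scheme.ΓSpecIso (.of (FractionRing (MvPolynomial (Fin r) k)))).inv.hom).toAlgebra
  haveI : Algebra.FiniteType (FractionRing (MvPolynomial (Fin r) k)) Γ(Y, V) := h1.comp h2
  letI := TopCat.Presheaf.algebra_section_stalk Y.presheaf (⟨y, hyV⟩ : V)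
  haveI : IsLocalization.AtPrime (Y.presheaf.stalk y) (hV.primeIdealOf ⟨y, hyV⟩).asIdeal := hV.isLocalization_stalk ⟨y, hyV⟩
  -- spread out
  obtain ⟨B₀, _, _, _, hB₀ft, x, hxp, algB₀L, hloc, hmax⟩ :=
    exists_spread_ring k r Γ(Y, V) (hV.primeIdealOf ⟨y, hyV⟩).asIdeal (Y.presheaf.stalk y)
  letI := algB₀L
  haveI := hloc
  haveI := hxp
  -- `X := Spec B₀` over `k`, the point `x`, NOT closed since `r ≥ 1`
  let x₀ : Spec (.of B₀) := ⟨x, hxp⟩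
  have hx₀ : ¬ IsClosed ({x₀} : Set (Spec (.of B₀))) := fun hcl => by
    have := hmax ((PrimeSpectrum.isClosed_singleton_iff_isMaximal x₀).mp hcl)
    omega
  haveI hft₀ : LocallyOfFiniteType (Spec.map (CommRingCat.ofHom (algebraMap k B₀))) :=
    HasRingHomProperty.Spec_iff.mpr (RingHom.finiteType_algebraMap.mpr hB₀ft)
  -- the stalk isomorphism `𝒪_{X,x} ≅ B_𝔮 = 𝒪_{Y,y}`
  let ε : (Spec (.of B₀)).presheaf.stalk x₀ ≅ Y.presheaf.stalk y :=
    Spec.stalkIso (.of B₀) x₀ ≪≫ (IsLocalization.algEquiv x.primeCompl (Localization.AtPrime x) (Y.presheaf.stalk y)).toRingEquiv.toCommRingCatIso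
  -- local dimension `e ≥ 4`
  have hdimy : ringKrullDim (Y.presheaf.stalk y) = e := FTemkinClosedPoints.ringKrullDim_stalk_eq_of_isClosed g hdim y hy
  have h4 : (4 : WithBot ℕ∞) ≤ ringKrullDim ((Spec (.of B₀)).presheaf.stalk x₀) := by
    rw [ringKrullDim_eq_of_ringEquiv ε.commRingCatIsoToRingEquiv, hdimy]
    exact_mod_cast he
  -- (LR_adm) at `(k, Spec B₀, x₀)`, transported
  exact NonClosedPointChart.localBody_of_iso ε.symm
    (h p hp k (Spec (.of B₀)) (Spec.map (CommRingCat.ofHom (algebraMap k B₀))) inferInstance hft₀ inferInstance inferInstance x₀ hx₀ h4)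

/-! ## §3 The equivalence -/

/-- ★ **(LR_adm) ⟺ the transcendental-field rungs at all levels `e ≥ 4`, `r ≥ 1`**: door v37's registered resolution-side stub
`RegularOffFiniteOfLRAdm.LocalResolutionNonClosedGe4Adm` is EQUIVALENT to «closed-point admissible local resolution of `e`-folds over `k(X₁,…,X_r)`, for
every prime `p`, every `e ≥ 4` and every `r ≥ 1`». [OURS · reduction; folklore] [cite: EGAIV3, (8.8.2); Temkin2008, Prop. 2.3.4 (iii)] -/
theorem localResolutionNonClosedGe4Adm_iff_tr :
    RegularOffFiniteOfLRAdm.LocalResolutionNonClosedGe4Adm ↔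
      ∀ p e r : ℕ, p.Prime → 4 ≤ e → 1 ≤ r → ClosedPointLocalResolutionAdmTr p e r :=
  ⟨closedPointLocalResolutionAdmTr_of_LRadm, localResolutionNonClosedGe4Adm_of_tr⟩

end Summit.ResolutionOfSingularities.ResolutionOfSingularities.Theorems.FInjectiveMacaulayfication.LRadmIffTr

end
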